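import Summits.BirchSwinnertonDyer.BirchSwinnertonDyer.Theorems.EdixhovenFibreFiveSevenTwistDegreeStepFiveSevenUnitTwist
import Summits.BirchSwinnertonDyer.BirchSwinnertonDyer.Theorems.EdixhovenFibreFiveSevenTwistDegreeStepFiveSevenAddvUnitTwist
import Summits.BirchSwinnertonDyer.Rank1Residual.Additive.GordTwistMinimalModel
import Summits.BirchSwinnertonDyer.Rank1Residual.X2.IsogenyClassStability
import Summits.BirchSwinnertonDyer.Rank1Residual.X12.CMIsogenyInvariance
import HarnessLib

/-!
# Route `AdditiveKolyvaginRoad`, crux `ManinFrameResidueProperR` (stmt-BirchSwinnertonDyer-20709), line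
# `tame_twist`: the registered stub `stub_memberManinUnit_fiveSeven_torsion` (the Kosters–Pannekoek sub-residue
# at `p ∈ {5, 7}`) GRANTED F″ and the two unit-twist inputs L-TWIST, TORS-TWIST — `--supports`, helper

Cell `pub/bsd-wall`, seat `bsd-line-edix-p2` (prover on the sibling line `EdixhovenFibreFiveSeven`, whose crux TDS57
has the SAME residue). THEOREMS ONLY; route-free (binder list spelled out). Nothing is closed; BSD is not proved.

The stub (registered by bsd-wall-manin-p1 g5, 2026-08-27T23:24Z) asks, on an AKR pair `(W, p)` with `5 ≤ p < 11`,
`Addv`, `Irr`, residue and degree clauses, AND a member of the class with a `ℚ_p`-rational point of order `p`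
(`hT`), for a globally minimal member with a Manin-unit datum at level `N(W)`. This is the Kosters–Pannekoek
sub-residue where the lever `not_dvd_c_of_tameTwist57` does not apply. The AUXILIARY-UNIT-TWIST repair of
`Theorems/EdixhovenFibreFiveSevenTwistDegreeStepFiveSevenUnitTwist.lean` (p584459) handles it GRANTED F″ (the
line's other stub `stub_katoNeronFiveLe`) and two inputs with printed/elementary provenance:
* L-TWIST `hLT` — twisted-period decomposition `Λ(f) ⊆ g(χ)Λ(f ⊗ χ) + pΛ(f)` for an auxiliary quadratic `χ` of odd
  prime conductor `q ∤ pN` (⟸ Ihara's lemma `ModularForms.ribet1984_iharaLemma`; seat memo TDS57-KP-RESIDUE-MEMO-v2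
  §2, evidence on stmt-22227);
* TORS-TWIST `hTT` — for `(q*/p) = −1`, the class of `E ⊗ χ_{q*}` has no `ℚ_p`-rational `p`-torsion when the class
  of `E` has some and `E[p]` is irreducible (elementary Galois / Kosters–Pannekoek Cor. 2 residues).
The third input (additivity of the unit twist) is the tree theorem `AddvUnitTwist.addv_of_model_twist_auxPrime`.
So `stub_memberManinUnit_fiveSeven_torsion` ⟸ F″ ∧ L-TWIST ∧ TORS-TWIST: the lead may reshape the stub into these.

References: [Stevens1989] Lemma (5.2); [Ribet1984ICM] Thm. 4.1; [Kato2004Asterisque] (8.1.3), Thm. 9.7;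
[KostersPannekoek2017] Thm. 1, Cor. 2; [EdixhovenManin1991] §4.
-/

set_option autoImplicit false
-- the Theorems directory repeats the summit name (sibling precedent `SignedBaseChangeAssembly.lean`)
set_option linter.dupNamespace false

noncomputable section

open scoped Classical MatrixGroups

open WeierstrassCurve NumberField Literature.NumberTheory.EllipticCurves
  Literature.NumberTheory.EllipticCurves.ModularForms
  Literature.NumberTheory.EllipticCurves.Rank1Residual
  Literature.NumberTheory.DiophantineGeometry IsDedekindDomain Rat.HeightOneSpectrum
  Summit.BirchSwinnertonDyer.Rank1Residual Summit.BirchSwinnertonDyer.Rank1Residual.Additive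
  Summit.BirchSwinnertonDyer.BirchSwinnertonDyer.Theorems CongruenceSubgroup

namespace Summit.BirchSwinnertonDyer.BirchSwinnertonDyer.Theorems.ManinFrameResidueProperRTameTwistUnitTwist

/-- A datum with `p ∤ c` at level `N` is one at any level `M = N`. [folklore] -/
private theorem exists_datum_not_dvd_of_level_eq {W : WeierstrassCurve ℚ} {N M : ℕ} [NeZero N]
    [NeZero M] (h : N = M) {p : ℕ} (D : ModularParametrizationData W N) (hc : ¬ (p : ℤ) ∣ D.c) :
    ∃ D' : ModularParametrizationData W M, ¬ (p : ℤ) ∣ D'.c := by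
  subst h
  exact ⟨D, hc⟩

/-- **Dirichlet's auxiliary prime** for `p ∈ {5, 7}`: a prime `q > n`, `q ≠ 2`, `q ≠ p`, `q ≡ 1 (mod 4)` (so
`q* = q`), with `q*` a non-square mod `p` (`q ≡ 13 mod 20`, resp. `q ≡ 5 mod 28`; Mathlib
`Nat.forall_exists_prime_gt_and_eq_mod`). [folklore] -/
private theorem exists_auxPrime_mod_four {p : ℕ} (hp57 : p = 5 ∨ p = 7) (n : ℕ) :
    ∃ q : ℕ, n < q ∧ q.Prime ∧ q ≠ 2 ∧ q ≠ p ∧ q % 4 = 1 ∧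
      ¬ IsSquare ((((-1 : ℤ) ^ (q / 2) * q : ℤ)) : ZMod p) := by
  rcases hp57 with rfl | rfl
  · have hu : IsUnit (((13 : ℕ) : ZMod 20)) := by
      rw [← ZMod.coe_unitOfCoprime 13 (by norm_num : Nat.Coprime 13 20)]
      exact Units.isUnit _
    obtain ⟨q, hqn, hq, hqmod⟩ := Nat.forall_exists_prime_gt_and_eq_mod hu n
    have hmod : q % 20 = 13 % 20 := (ZMod.natCast_eq_natCast_iff' q 13 20).mp hqmod
    have heven : Even (q / 2) := ⟨5 * (q / 20) + 3, by omega⟩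
    have hstar : ((-1 : ℤ) ^ (q / 2) * q : ℤ) = q := by rw [heven.neg_one_pow, one_mul]
    refine ⟨q, hqn, hq, by omega, by omega, by omega, ?_⟩
    rw [hstar, Int.cast_natCast, (ZMod.natCast_eq_natCast_iff' q 3 5).mpr (by omega)]
    decide
  · have hu : IsUnit (((5 : ℕ) : ZMod 28)) := by
      rw [← ZMod.coe_unitOfCoprime 5 (by norm_num : Nat.Coprime 5 28)]
      exact Units.isUnit _
    obtain ⟨q, hqn, hq, hqmod⟩ := Nat.forall_exists_prime_gt_and_eq_mod hu n
    have hmod : q % 28 = 5 % 28 := (ZMod.natCast_eq_natCast_iff' q 5 28).mp hqmod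
    have heven : Even (q / 2) := ⟨7 * (q / 28) + 1, by omega⟩
    have hstar : ((-1 : ℤ) ^ (q / 2) * q : ℤ) = q := by rw [heven.neg_one_pow, one_mul]
    refine ⟨q, hqn, hq, by omega, by omega, by omega, ?_⟩
    rw [hstar, Int.cast_natCast, (ZMod.natCast_eq_natCast_iff' q 5 7).mpr (by omega)]
    decide

/-- **The registered stub `stub_memberManinUnit_fiveSeven_torsion` of crux 20709 (binder list VERBATIM), GRANTED
F″ (`hK`) and the unit-twist inputs L-TWIST (`hLT`) and TORS-TWIST (`hTT`).** Proof: `p ∈ {5, 7}`; the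
`X₀(N)`-optimal member `V₀ ∼ W` with its lattice-optimal datum (`X12.exists_isIsogenous_optimal`); Dirichlet's
auxiliary prime `q ≡ 13 (20)` / `≡ 5 (28)`, `q > N` (Mathlib `Nat.forall_exists_prime_gt_and_eq_mod`); a globally
minimal model `Vχ` of `V₀ ⊗ χ_{q*}` (`exists_minimal_twist_pStar`), additive at `p`
(`AddvUnitTwist.addv_of_model_twist_auxPrime`), with no `ℚ_p` `p`-torsion on its class (`hTT`, the witness `hT`
moved to the class of `V₀`); `√q* ∈ ℂ`; then `TwistDegreeStepFiveSevenUnitTwist.not_dvd_optimal_c_of_kato_of_unitTwist`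
(lever on the twisted class + Stevens (5.2) + `hLT`) gives `p ∤ c₀`, at level `N(V₀) = N(W)`. The binders `dd`,
`hres`, `hall` are not used. CONDITIONAL; nothing closed; BSD is not proved by this.
[cite: Stevens1989, Lemma (5.2) p. 96] [cite: Ribet1984ICM, Thm. 4.1] [cite: Kato2004Asterisque, Thm. 9.7 (p. 189)] -/
theorem stub_memberManinUnit_fiveSeven_torsion_of_twistInputs
    (hK : kato_neron_isIntegral_twistedSymbolSum_of_additive_five_le)
    (hLT : ∀ (p : ℕ) [Fact p.Prime] (q : ℕ) [Fact q.Prime] (V₀ : WeierstrassCurve ℚ) [V₀.IsElliptic]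
      [V₀.IsGloballyMinimal] [NeZero (V₀.conductorNorm ℤ)]
      (D₀ : ModularParametrizationData V₀ (V₀.conductorNorm ℤ)), 5 ≤ p → Irr V₀ p → q ≠ 2 → q ≠ p →
      ¬ q ∣ V₀.conductorNorm ℤ →
      ∀ (Vχ : WeierstrassCurve ℚ) [Vχ.IsElliptic] [Vχ.IsGloballyMinimal] (v : VariableChange ℚ),
      v • V₀.quadraticTwist (((-1 : ℤ) ^ (q / 2) * q : ℤ) : ℚ) = Vχ →
      ∀ (s : ℂ), s ^ 2 = (((-1 : ℤ) ^ (q / 2) * q : ℤ) : ℂ) →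
      ∀ (N' : ℕ) [NeZero N'] (g : CuspForm (Gamma0 N') 2), IsNewformOf Vχ g →
      ∀ z ∈ periodLattice D₀.f, ∃ w ∈ periodLattice g, ∃ y ∈ periodLattice D₀.f, z = s * w + (p : ℂ) * y)
    (hTT : ∀ (p : ℕ) [Fact p.Prime] (q : ℕ) [Fact q.Prime] (V₀ : WeierstrassCurve ℚ) [V₀.IsElliptic]
      [V₀.IsGloballyMinimal], 5 ≤ p → Irr V₀ p → q ≠ p →
      ¬ IsSquare ((((-1 : ℤ) ^ (q / 2) * q : ℤ)) : ZMod p) →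
      (∃ (W' : WeierstrassCurve ℚ) (_ : W'.IsElliptic) (_ : W'.IsGloballyMinimal)
        (P : (W'.baseChange ℚ_[p]).toAffine.Point), IsIsogenous V₀ W' ∧ P ≠ 0 ∧ p • P = 0) →
      ∀ (Vχ : WeierstrassCurve ℚ) [Vχ.IsElliptic] [Vχ.IsGloballyMinimal] (v : VariableChange ℚ),
      v • V₀.quadraticTwist (((-1 : ℤ) ^ (q / 2) * q : ℤ) : ℚ) = Vχ →
      ∀ (W'' : WeierstrassCurve ℚ) [W''.IsElliptic] [W''.IsGloballyMinimal], IsIsogenous Vχ W'' →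
      ∀ Q : (W''.baseChange ℚ_[p]).toAffine.Point, p • Q = 0 → Q = 0)
    (_dd : dokchitser_padicValInt_minimalDiscriminantInt_eq_of_isogeny_of_not_dvd_degree)
    (hnf : exists_isNewformOf)
    (W : WeierstrassCurve ℚ) [W.IsElliptic] [W.IsGloballyMinimal] (p : ℕ) [hp : Fact p.Prime]
    [NeZero (W.conductorNorm ℤ)] (hp5 : 5 ≤ p) (hp11 : p < 11) (hadd : Addv W p) (hirr : Irr W p)
    (_hres : ((p < 11 ∨ ∃ (W' : WeierstrassCurve ℚ) (_ : W'.IsElliptic) (_ : W'.IsGloballyMinimal),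
          IsIsogenous W W' ∧ TypeGOrd W' p ∧ padicValInt p W'.minimalDiscriminantInt ≤ 4) ∧
        (∃ (W' : WeierstrassCurve ℚ) (_ : W'.IsElliptic) (_ : W'.IsGloballyMinimal),
          IsIsogenous W W' ∧ ∀ (v : HeightOneSpectrum ℤ) (n : ℕ), natGenerator v = p →
            W'.kodairaSymbolAt v ≠ KodairaSymbol.Istar n)))
    (_hall : (∀ (W' : WeierstrassCurve ℚ) [W'.IsElliptic] [W'.IsGloballyMinimal]
          (D' : ModularParametrizationData W' (W.conductorNorm ℤ)),
          IsIsogenous W W' → p ∣ D'.modularDegree))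
    (hT : ∃ (W' : WeierstrassCurve ℚ) (_ : W'.IsElliptic) (_ : W'.IsGloballyMinimal),
      IsIsogenous W W' ∧ ∃ P : (W'.baseChange ℚ_[p]).toAffine.Point, p • P = 0 ∧ P ≠ 0) :
    ∃ (W₀ : WeierstrassCurve ℚ) (_ : W₀.IsElliptic) (_ : W₀.IsGloballyMinimal)
        (D₀ : ModularParametrizationData W₀ (W.conductorNorm ℤ)),
        IsIsogenous W W₀ ∧ ¬ (p : ℤ) ∣ D₀.c := by
  have hpP : p.Prime := hp.out
  have hp57 : p = 5 ∨ p = 7 := by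
    interval_cases p <;>
      first | exact Or.inl rfl | exact Or.inr rfl | exact absurd hpP (by decide)
  obtain ⟨W', hE', hM', hisoW', P, hP, hP0⟩ := hT
  -- the optimal member of the class of `W`
  obtain ⟨V₀, hE₀, hM₀, hNz₀, D₀, hiso, hN, hopt₀⟩ := X12.exists_isIsogenous_optimal hnf W
  haveI := hE₀
  haveI := hM₀
  haveI := hNz₀
  have hirr₀ : Irr V₀ p := (X12.irr_iff_of_isIsogenous hiso p).mp hirr
  have hadd₀ : Addv V₀ p := (X2.addv_iff_of_isIsogenous (p := p) hiso).mp hadd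
  have hisoVW : IsIsogenous V₀ W' := (hiso.symm_of_charZero).trans' hisoW'
  -- the auxiliary prime
  obtain ⟨q, hqN, hq, hq2, hqp, -, hnsq⟩ := exists_auxPrime_mod_four hp57 (V₀.conductorNorm ℤ)
  haveI : Fact q.Prime := ⟨hq⟩
  have hqN' : ¬ q ∣ V₀.conductorNorm ℤ := fun h ↦
    absurd (Nat.le_of_dvd (Nat.pos_of_ne_zero (NeZero.ne _)) h) (by omega)
  have hqsq : ¬ q ^ 2 ∣ V₀.conductorNorm ℤ := fun h ↦ hqN' ((dvd_pow_self q two_ne_zero).trans h)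
  have hgm : V₀.HasGoodReductionAtPrime q ∨ V₀.HasMultiplicativeReductionAtPrime q :=
    hasGoodReductionAtPrime_or_hasMultiplicativeReductionAtPrime_of_not_sq_dvd_conductorNorm (V := V₀) hqsq
  -- the twisted model, additive at `p`, torsion-free class, square root of `q*`
  obtain ⟨Vχ, hEχ, hMχ, v, hv⟩ := exists_minimal_twist_pStar q V₀
  haveI := hEχ
  haveI := hMχ
  haveI : NeZero (Vχ.conductorNorm ℤ) := ⟨(Vχ.conductorNorm_pos_holds).ne'⟩
  have hv' : v • V₀.quadraticTwist (((-1 : ℤ) ^ (q / 2) * q : ℤ) : ℚ) = Vχ := by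
    rw [(pStar_intCast q).1]; exact hv
  obtain ⟨s, hs2⟩ := IsAlgClosed.exists_pow_nat_eq ((((-1 : ℤ) ^ (q / 2) * q : ℤ)) : ℂ) two_pos
  have haddχ : Addv Vχ p := AddvUnitTwist.addv_of_model_twist_auxPrime (by omega) hq hqp hadd₀ ⟨v, hv'⟩
  have hPTχ := hTT p q V₀ hp5 hirr₀ hqp hnsq ⟨W', hE', hM', P, hisoVW, hP0, hP⟩ Vχ v hv'
  have hL := hLT p q V₀ D₀ hp5 hirr₀ hq2 hqp hqN' Vχ v hv' s hs2
  -- the repair at the optimal member, then the level `N(V₀) = N(W)`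
  have hc₀ : ¬ (p : ℤ) ∣ D₀.c :=
    TwistDegreeStepFiveSevenUnitTwist.not_dvd_optimal_c_of_kato_of_unitTwist hK hnf hp57 V₀ hirr₀ D₀ hopt₀ hq2
      hgm Vχ v hv' haddχ hPTχ s hs2 hL
  obtain ⟨D₀', hc₀'⟩ := exists_datum_not_dvd_of_level_eq hN D₀ hc₀
  exact ⟨V₀, hE₀, hM₀, D₀', hiso, hc₀'⟩

end Summit.BirchSwinnertonDyer.BirchSwinnertonDyer.Theorems.ManinFrameResidueProperRTameTwistUnitTwist

end
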